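import Mathlib
import HarnessLib
import HarnessLib.Audit
import Summits.FinalStateConjecture.Statement

/-!
Route: LateLocalKicks

DORMANT since 2026-09-04T18:00:38Z (reconciler: no traction for 5 d (last activity statement-checked at 2026-08-30T17:29:20Z); parked, not closed — `ledger route dormant route-FinalStateConjecture-LateLocalKicks --off` to reactivate) — unstaffed, not closed; items shared with open routes are served there. `ledger route dormant <id> --off` reactivates.

# Route LateLocalKicks — all politics is local — typed Christodoulou-genericity of the final state
is decided by ONE-SIDED LOCAL kicks on LATE pinned co-slices (transport, gauge-shear two-from-one,
slice independence)

It suffices to show X = LateKick ∧ SliceIndependence ∧ KickTransport ∧ OneSidedSuffices ∧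
TameWitnessOfLocalFamily ∧ MGHDExists (route for card
all-politics-is-local-late-one-sided-kicks; items re-typed 2026-08-16 to the T2 Statement, p126844;
crux-only deciding theorem since rev 3;
logic-only `closes` over a Statement-only import cone since rev 5). Legend, let-bound verbatim in
every item (X fixed, 𝓓 = admissibleVacuumData X):
Q(D) := the summit conclusions for EVERY maximal vacuum Cauchy development of D (complete 𝓘⁺ in the
sojourn form ∧ an exhaustive,
future-oriented charted decomposition into finitely many SUB-extremal boosted Kerr near zones plus a
flat radiation zone on O = J⁺(ιX) ∩ I⁻(charts),
every future-complete normalised null ray from the data staying in closure O — verbatim the settling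
clause of the re-typed Statement:
HasCompleteNullInfinity ∧ ∃ O dd, sub-extremal ∧ O = exteriorOf ∧ RaysStayInClosure ∧
HasExhaustiveCharts ∧ IsFutureOriented) — the
summit property is (∃ MGHD) ∧ Q; Local(D, G) := G : ℝ¹ → data is a jointly smooth
(IsSmoothDataFamily 1) family through D, every member
admissible, equal to D (h and k pointwise) outside ONE compact set — a LOCAL KICK; CoSlice(D, D′) :=
D and D′ are induced on two Cauchy
hypersurfaces of one common vacuum Cauchy development and the two embeddings agree outside a compact
set — a PINNED CO-SLICE (intended
use: D′ = a late slice of the development of D, pushed to the future only over a compact region).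
LateKick (crux, all the physics): every
admissible d with ¬Q d has an admissible pinned co-slice d′ carrying a local kick G′ with Q(G′ c)
for all 0 < c < δ (ONE-SIDED).
SliceIndependence (crux, typing): CoSlice d d′ ∧ (∃ MGHD of d′) ∧ Q d′ → Q d. KickTransport
(support, Cauchy stability): local kicks through
d′ pull back to local kicks through d that are member-wise pinned co-slices. OneSidedSuffices (gauge
shear; crux rank 9): a one-sided local
kick into Q through d yields a two-sided LOCAL (equal to d off one compact set) curve through d,
IMMERSED at 0, injective and admissible
for |c₀| < ε, with Q off 0. TameWitnessOfLocalFamily (TAME PACKAGING; shared with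
RobustClausewiseGenericity, stmt-FinalStateConjecture-17502, crux rank 9; provable now, complete
candidate proof in evidence): for every
property P, a local (equal to d off one compact set) immersed window family through each admissible
d failing P, injective and admissible
on the window with P off 0, witnesses IsTameChristodoulouGeneric 𝓓 P 1 (collared sole end, same
mass, wDist ≡ 0; proved Literature:
`InitialDataSet.isTameDataFamily_restrict_of_agree_off_compact_one`,
`InitialDataSet.isTameChristodoulouGeneric_of_localWindow`).
MGHDExists (shared, crux rank 9): CBG. KickTransport, OneSidedSuffices, TameWitnessOfLocalFamily,
MGHDExists are known-theorem /
provable-now statements, crux-KINDED at rank 9 only by the D-0027 layer invariant (every unproved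
hypothesis of the crux-only `closes` is a
crux). Since rev 5 (route-repair, cone; 2026-08-17) the route file imports NOTHING beyond the
Statement: the rev-4 in-Lean discharge of the
packaging imported TameFamilyOffCompact, whose import cone (AFEndRestrict → AsymptoticallyFlatChart
→ AsymptoticallyFlatCompleteness →
PositiveMassRigidity → MassInequalities) carries 11 unproved XL named facts of the positive-mass /
Penrose family that no decl of this route
uses but that blocked staffing; the packaging is therefore the shared item again, whose Theorems
proof may import TameFamilyOffCompact
freely (Theorems files are never re-imported into the Theses file).
Lean: `LateKick ∧ SliceIndependence ∧ KickTransport ∧ OneSidedSuffices ∧ TameWitnessOfLocalFamily ∧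
MGHDExists`

## Assembly
The deciding theorem `closes : LateKick → SliceIndependence → KickTransport → OneSidedSuffices →
TameWitnessOfLocalFamily → MGHDExists →
FinalStateConjecture` (crux-only, D-0027 §2.1; logic only; glue.lean; Sketch.lean lean check rc 0, 0
sorries, axioms propext /
Classical.choice / Quot.sound, 2026-08-17; the route file imports the Statement only): fix X;
`FinalStateConjecture` at X is
`IsTameChristodoulouGeneric 𝓓 P 1` with P D := (∃ MGHD of D) ∧ Q D; apply TameWitnessOfLocalFamily
at this P, so it remains to produce,
through every admissible d with ¬P d, a window family: jointly smooth, F 0 = d, immersed at 0, equal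
to d (h and k pointwise) off one
compact K, injective and admissible for |c₀| < ε, P for 0 < |c₀| < ε.
MGHDExists gives ∃ MGHD, hence ¬Q d; LateKick gives d′, the co-slice witness, a local kick G′
through d′ and δ′ with Q(G′ c) for
0 < c₀ < δ′; KickTransport gives a local kick G through d and δ with CoSlice (G c) (G′ c) for |c₀| <
δ; for 0 < c₀ < min δ δ′,
SliceIndependence (with MGHDExists at G′ c) yields Q(G c); OneSidedSuffices turns (G, min δ δ′) into
ε and a jointly smooth F through d,
immersed at 0, equal to d off a compact K, injective and admissible for |c₀| < ε, with Q(F c) for 0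
< |c₀| < ε; MGHDExists at F c
upgrades Q(F c) to P(F c). The Assembly item records the same 6-crux chain as a statement
(stmt-FinalStateConjecture-18062,
restated at rev 6 from the rev-4 5-chain, which omitted TameWitnessOfLocalFamily and leaned on the
dropped import for its proof; proof of
the item = `closes`).
History: rev 1 (2026-08-15) `closes` unfolded `IsChristodoulouGeneric` and stopped elaborating at
the Statement re-type T2 (p126844);
rev 2 (2026-08-16) restated LateKick, SliceIndependence, OneSidedSuffices 1:1 to the T2 clause with
a logic-only `closes` over support
hypotheses; revs 3–4 made `closes` crux-only (rev 3 re-badged the three known-theorem supports crux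
rank 9; rev 4 discharged the packaging in Lean,
restated the Assembly to the crux-only chain and dropped TameWitnessOfLocalFamily); rev 5
(2026-08-17, route-repair cone) re-attached
TameWitnessOfLocalFamily as a rank-9 crux, made `closes` logic-only over it and dropped both
Literature imports (rev 6: Assembly restated to the 6-chain) — the 11 unproved
positive-mass-family facts (MassInequalities.lean, PositiveMassRigidity.lean) left the import cone
(84 → 27 modules), none having been used.

Rationale: WHY THIS LINE. The typed quantifier (`IsTameChristodoulouGeneric 𝓓 P 1` since the re-type T2,
p126844) constrains the witness family only AT INFINITY
(one fixed end, DR rates, wDist-continuity, immersion at 0) and says nothing about WHERE in the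
interior or HOW the escaping curve is found —
compactly supported kicks are tame for free (members agree with d on the end: same end, same mass,
wDist ≡ 0) — so the slack is intact: this route
makes "late, local, one-sided" without loss of generality by three lemmas of standard mathematics
pointed at the quantifier — Cauchy
stability on a compact slab (HawkingEllis1973 §7.6, time-reversed; ChoquetBruhatGeroch1969CMP;
Kato1975) transports local kicks between
pinned co-slices; a compactly supported GAUGE SHEAR (diffeomorphism pull-back, BartnikIsenberg2004
§2, the injectivity device already
typed in-pool as RobustClausewiseGenericity.GaugeEnrichment) thickens a one-sided arc into an
injective two-sided curve, so NO openness /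
asymptotic-stability statement is needed for two-from-one (the card's K3 drops out); and slice
independence of the typed conclusions
(causal convexity of common developments, proved MGHD rigidity `mghd_unique_cauchy`) moves goodness
back to the early slice. What is
left is exactly Christodoulou's two-step architecture (Christodoulou1999instability Thms 3.1/4.1 +
§5: all-data dichotomy, then a
designed late local push; LukOh2017 Step 4: the offence is read late and the perturbation placed
where it is read) as ONE typed crux,
LateKick, for the vacuum final state. Imported: hyperbolic PDE (Cauchy stability, smooth
dependence), Lorentzian causality (Cauchy
hypersurfaces of common developments), the diffeomorphism group as a free second parameter (it now
also supplies the IMMERSION at 0 that T2 demands: the gauge direction has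
non-zero first derivative at the datum). No prior route states a WLOG reduction of
the typed quantifier; RobustClausewiseGenericity pays the conjunction tax by robust clause-wise
escape, SwallowTheDatum exploits
non-local burial families (the opposite use of the slack), QuietWindowCapture is near-Kerr capture;
negatives index empty.

RANKED CRUXES. #2 LateKick (crux) — LATE ONE-SIDED LOCAL KICKABILITY (card K1+K2, merged because
'quiet bad models' are not typable today; legend Q re-typed T2: + RaysStayInClosure, +
IsFutureOriented). For every admissible datum d on X with ¬Q d (some maximal vacuum Cauchy
development of d lacks complete 𝓘⁺ or an exhaustive, future-oriented, ray-covering sub-extremal Kerr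
decomposition) there are an admissible d′ with CoSlice d d′ (d′ is induced on another Cauchy
hypersurface of a common vacuum Cauchy development of d, the two embeddings equal off a compact set
— by intent a LATE, ε-quiet slice pushed to the future over a compact region) and a local kick G′
through d′ (IsSmoothDataFamily 1, G′ 0 = d′, all members admissible, G′ c = d′ off one compact K)
with ∃ δ > 0, Q(G′ c) for all parameters 0 < c < δ. Physics content: Christodoulou's all-data
alternative theorem on quiet late slices (hair / creep to extremality / pre-naked-singularity
profile / luminal core / cascade tail) AND a one-sided compactly supported constraint-satisfying
cure of every offender at once. [difficulty: open-problem] (why it might fail: Needs an all-data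
late classification AND a one-sided cure of EVERY offender at once: unknown quiet species; no vacuum
hair-instability/no-hair theorem; naked-singularity instability only in symmetry (vacuum examples:
RSR2023); thresholds accumulating from the kicked side; inseparable offenders.)
[Christodoulou1999instability, Christodoulou1999, DafermosLuk2017, RodnianskiShlapentokhRothman2023,
An2025, KehleUnger2024, LukOh2017, CarlottoSchoen2014]
#3 SliceIndependence (crux) — SLICE INDEPENDENCE OF THE TYPED CONCLUSIONS ALONG PINNED CO-SLICES
(legend Q re-typed T2). For admissible d, d′ on X with CoSlice d d′: if d′ has a maximal vacuum
Cauchy development and Q d′ holds, then Q d holds. Proof plan (no PDE): an MGHD 𝒟₁ of d receives the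
common development (maximality); its image is causally convex because it contains the Cauchy
hypersurface ι₁(X), so the co-slice is Cauchy in 𝒟₁; with an MGHD of d′, mutual embeddings plus
one-jet rigidity (`DataEmbedding.eq_id_of_comp_embed_eq'`, `mghd_unique_cauchy`, proved) make 𝒟₁
re-anchored at the co-slice an MGHD of d′, to which Q d′ applies; then transfer the two conclusions
across anchors differing on a compact C: sojourn completeness (rays and the normalisation g(γ′,ν) =
−1 agree off C; B₀ ↦ ι⁻¹((J⁻ ∪ J⁺)(ι′B₀′) ∩ ιX), B₁ ↦ B₁′ ∪ C) and the decomposition (same charts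
truncated to a later τ₀, region O = J⁺(ιX) ∩ I⁻(charted), exhaustiveness across the compact slab
J⁺(ιC) ∩ J⁻(ι′X) from HasExhaustiveCharts at every τ₁; IsFutureOriented is chart-intrinsic and
transfers verbatim; RaysStayInClosure re-anchors because a normalised future-complete null ray from
ι p crosses the Cauchy co-slice once and continues, up to positive affine rescaling, as a normalised
ray from ι′ p′, its points outside the compact inter-slice region approximate from O once they
approximate from O′, and the remaining compact stretch is handled by p ∈ I⁺(ιX) ∩ J⁻(q), q ∈ closure
O ⇒ p ∈ closure O). [difficulty: L] (why it might fail: The typed conclusions are ANCHORED at the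
data slice (sojourn rays and RaysStayInClosure from ι(X); O = J⁺(ιX) ∩ I⁻(charts);
HasExhaustiveCharts ∀ τ₁ > τ₀): re-anchoring a FinalStateDecomposition across the compact slab
between two unordered pinned slices may fail as typed — then the Statement is slice-dependent.)
[ONeillSemiRiemannian1983, ChoquetBruhatGeroch1969CMP, Sbierski2016AHP, Ringstrom2009,
DafermosLuk2017]
#9 KickTransport (crux rank 9 since rev 3 — an unproved hypothesis of the crux-only `closes`, hence
a crux by the D-0027 layer invariant; by content card L1, a known theorem, XL formalisation) —
CAUCHY-STABILITY TRANSPORT OF LOCAL KICKS ALONG PINNED CO-SLICES. For admissible d, d′ with CoSlice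
d d′ and every local kick G′ through d′ there are a local kick G through d and δ > 0 such that
CoSlice (G c) (G′ c) for all |c| < δ. Proof plan: time-reversed Cauchy stability theorem
(HawkingEllis1973 §7.6, property (1) = pinning) on a region 𝒱 with compact closure containing the
slab between the two slices over C and the domain of influence of the kick support; smooth joint
dependence on c (Kato1975, differentiate the reduced equations in c) gives IsSmoothDataFamily 1;
constraints for induced data, completeness and the DR end are inherited because G c = d off ONE
compact set (finite speed of propagation); beyond δ reparametrise c smoothly into (−δ, δ). No
weighted norms: locality first, then transport. [difficulty: XL] (why it might fail: only as typed —
ONE compact K for all c and joint C^∞ in (c, x) of the transported data, admissibility of every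
member, CoSlice unoriented (d′ may dip to the past of ιX); smooth c-dependence of MGHD slabs for
this class is folklore (Kato) rather than in print.) [HawkingEllis1973, ChoquetBruhatGeroch1969CMP,
Kato1975, Ringstrom2009, FouresBruhat1952]
#9 OneSidedSuffices (crux rank 9 since rev 3, layer invariant; by content card L4, provable now) —
ONE-SIDED LOCAL KICKS SUFFICE, T2 form (two-from-one by a GAUGE SHEAR without openness, output local
and immersed). If an admissible d carries a local kick G with Q(G c) for 0 < c₀ < δ, then there are
ε > 0 and a jointly smooth F : ℝ¹ → data through d, IMMERSED at 0 (IsImmersedAtZero 1 F), equal to d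
(h and k pointwise) off ONE compact set, injective and admissible for |c₀| < ε, with Q(F c) for 0 <
|c₀| < ε — verbatim the hypothesis shape of TameWitnessOfLocalFamily with P ↦ Q. Construction: F(c)
:= ψ_{c₀}^*(G(β(c))) with β(c) = (δ/2)·c₀²/(1+c₀²)·e₀ ∈ [0, δ/2) (β > 0 off 0, β′(0) = 0) and ψ_s
the breathing-ball diffeomorphisms of Theorems/RobustClausewiseGenericityGaugeEnrichment.lean
(AFEnd.breatheFamily: supported in a chart ball B̄, ψ₀ = id, ψ_s(x₀) = x₀, Dψ_s(x₀) = (1+σ(s))·id;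
BartnikIsenberg2004 §2): (i) Q and admissibility are invariant under pull-back by a diffeomorphism ψ
of X (every MGHD of ψ^*D is an MGHD of D re-anchored along ψ; range ι, the family of rays from ι(X),
O, the charts, HasExhaustiveCharts and IsFutureOriented are unchanged, sojourn sets B ↦ ψ⁻¹B), so
Q(F c) ⇔ Q(G(β c)) for c ≠ 0; (ii) F c = d off K ∪ B̄; (iii) h_{F c}(x₀)(v,v) = (1+σ(c₀))²·h_{G(β
c)}(x₀)(v,v) (breatheFamily_h_inner_center) has c-derivative 2σ′(0)·h_d(x₀)(v,v) ≠ 0 at 0 (β′(0) =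
0), which is immersion at 0 and injectivity for |c₀| < ε. In-pool precedents:
RobustClausewiseGenericity.GaugeEnrichment (PROVED, gaugeEnrichment @0c79d3f2278a),
PointedGaugeEnrichment (stmt-FinalStateConjecture-17501); in Literature (proved):
AFEndBreathingData.breatheFamily_h_inner_center, TameBreathingCurve (isImmersedAtZero_breatheCurve,
injective_breatheCurve, breatheCurve_mem_admissibleVacuumData),
AdmissibleDataLocality.mem_admissibleVacuumData_of_agree_off_compact — the new piece is the
transport of developments and of Q along ψ. [difficulty: L] (why it might fail: hinges on Q(ψ^*D) ↔
Q(D): every typed MGHD of ψ^*D must re-anchor to one of D (IsMaximal over ALL typed developments)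
and the sojourn / ray clauses must be ψ-equivariant as typed.) [BartnikIsenberg2004,
Christodoulou1999, Christodoulou2008]
#9 TameWitnessOfLocalFamily (crux rank 9 since rev 5, layer invariant; shared item
stmt-FinalStateConjecture-17502, wanted also by
RobustClausewiseGenericity as support; provable now — grounded 2026-08-16 with a COMPLETE candidate
proof in evidence, TameWitnessScratch.lean
rc 0, 0 sorries) — LOCAL COMPACTLY SUPPORTED IMMERSED FAMILIES ARE TAME WITNESSES (the T2 packaging
lemma). For every property P of data on X:
if through every admissible d with ¬P d there is a jointly smooth F : ℝ¹ → data with F 0 = d,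
immersed at 0, equal to d (h and k pointwise)
off ONE compact K, injective and admissible for |c₀| < ε, with P(F c) for 0 < |c₀| < ε, then
IsTameChristodoulouGeneric (admissibleVacuumData X) P 1.
Proof plan (all proved Literature, no named fact): the sole DR-flat end e of d with mass M
(mem_admissibleVacuumData_iff), collared to
e.restrict (e.R + 1); the family is tame there by
InitialDataSet.isTameDataFamily_restrict_of_agree_off_compact_one (TameFamilyOffCompact.lean:
constant mass, wDist → 0 because members agree with d = F 0 off K); ‖c‖ = |c₀| on ℝ¹ converts the
windows; conclude by
InitialDataSet.isTameChristodoulouGeneric_of_localWindow (TameGenericityLocalWindow.lean) — verbatim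
the packaging block of the rev-4 `closes`
(route file @ 4c0fbc44f89c), to be landed in ONE Theorems file that may import TameFamilyOffCompact
(Theorems files are never re-imported
into the Theses file, so the route's import cone stays the Statement's). Why an item again (rev 5,
route-repair cone): the rev-4 discharge
inside `closes` imported TameFamilyOffCompact, whose cone AFEndRestrict → AsymptoticallyFlatChart →
AsymptoticallyFlatCompleteness →
PositiveMassRigidity → MassInequalities carries 11 unproved XL named facts
(positive_mass_theorem_riemannian / _spacetime,
positive_mass_rigidity, riemannian_penrose_inequality / _connected / _connected_smooth / _rigidity,
PenroseInequalityConjecture,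
schoenYau_mass_nonneg, scalarFlat_of_massZero, ricciFlat_of_scalarFlat_of_massZero) — NONE used by
any decl of this route; they ride in
because AsymptoticallyFlatCompleteness imports PositiveMassRigidity to discharge the fact
isComplete_of_isSoleEnd stated there (a Literature
layering issue worth a librarian split; until then every FSC route should keep AFEndRestrict /
TameFamilyOffCompact / AFEndBreathing* out of
its Theses imports). [difficulty: M] (why it might fail: only as typed — tameness on the collared
end needs every member's chart components
to agree with d's beyond R₁ = e.R + 1 including the junk values inside the collar, and the constant
mass read through
IsStronglyAsymptoticallyFlatDR.congr_of_eqOn_far; the candidate proof checks both.)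
[Christodoulou1999, arXiv:0811.0354, Bartnik1986]
#9 MGHDExists (crux rank 9 since rev 3, layer invariant; the summit's shared item
stmt-FinalStateConjecture-9937, crux-kinded in most sibling routes and staffed once) — MGHD
EXISTENCE for admissible data (Choquet-Bruhat–Geroch 1969 Thm 3; Sbierski 2016 Thm 2.6), stated over
the repaired structure `VacuumCauchyDevelopment`; the named fact
`choquetBruhat_geroch_exists_mghd_cauchy` restricted to the admissible class. Shared item of this
summit (stmt-FinalStateConjecture-9937, same signature); supplies the anti-vacuity conjunct (∃ MGHD)
for the early slice and for every member of the sheared curve (Q(F c) ⇒ P(F c)), and the hypothesis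
(∃ MGHD) of SliceIndependence at every G′ c. [difficulty: XL] (why it might fail: only as typed — in
print (CBG 1969 Thm 3) but here the undischarged fact choquetBruhat_geroch_exists_mghd_cauchy;
IsMaximal asks EVERY typed VacuumCauchyDevelopment.{0} of D to embed into one 𝒟, so a rogue typed
development falsifies it (first render over VacuumDevelopment: isEmpty).)
[ChoquetBruhatGeroch1969CMP, Sbierski2016AHP, Ringstrom2009]

TWO-LAYER PLAN. Foreseen glued split of LateKick (k = 3, depth 1, filed only when a prover or
refuter asks): LateKick ⇐ QuietAlternative → ModelKick →
Separation → LateKick, where QuietAlternative (card K1, all data, no genericity) = every MGHD either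
satisfies Q or admits, for every ε,
an admissible ε-quiet pinned co-slice on which each offender is δ(ε)-close, in its own frame and
scale, to one of an explicit finite list
of QUIET BAD MODELS (non-Kerr stationary vacuum hole; asymptotically extremal throat; truncated
self-similar profile before a first
naked point; luminal core; cascade tail) — typable once `InitialDataSet.IsQuietLateSliceOf` and the
model families are defined over
BondiMass/RadiatedEnergy/EventHorizonArea; ModelKick (card K2) = each model is one-sidedly locally
kickable into Q; Separation (card K3,
weakened) = on an ε-quiet slice kicks near distinct offenders compose (stability radius of Q at good
late configurations under far,
small, compactly supported perturbations). SliceIndependence may split by conjunct: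
NullInfinityReanchor → DecompositionReanchor →
SliceIndependence (k = 2). KickTransport, OneSidedSuffices, TameWitnessOfLocalFamily, MGHDExists
(rank-9 cruxes) are never split (prover lemmas ride with `--supports`).

KILL CRITERIA. (i) A refutation of LateKick by a NON-LATE-LOCALISABLE species inside
admissibleVacuumData — an exceptional datum none of whose pinned
co-slices admits a one-sided compactly supported admissible cure (e.g. a bad mechanism whose
certification needs a perturbation that is
large, early, or spread to infinity, or thresholds of bad behaviour accumulating at the datum from
the kicked side along EVERY local
family) — closes the route `refuted:LateKick`; hand the witness to SwallowTheDatum /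
prevalence-universal-pulse-probe (other registers).
(ii) SliceIndependence refuted AS TYPED (a pinned co-slice pair with Q d′, ∃MGHD d′, ¬Q d): the
typed Statement is slice-anchored — file
the witness as an audit finding on Statement.lean (HasExhaustiveCharts / sojourn anchoring); the
route pivots to the repaired Statement
(restate Q), it is not dead — done once without a refutation when the Statement itself was re-typed
(T2, p126844, 2026-08-16: Q restated 1:1, tame packaging added). (iii) KickTransport refuted as
typed can only be a typing defect of CoSlice/Local (uniform compact K, joint
C^∞): restate. (iv) FSC proved elsewhere moots the route; a proof of LateKick's split children
elsewhere feeds it.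

NOT DECOMPOSED YET. The species list inside LateKick (quiet alternative theorem vs per-model
kickability vs separation — layer-2 children above); the
budget-exhaustion lemma (Bondi energy, horizon area, rapidity variation → ε-quiet slices exist)
which lives inside QuietAlternative; the
causal-convexity / re-anchoring lemmas inside SliceIndependence; smooth parameter dependence and the
reparametrisation beyond δ inside
KickTransport; diffeomorphism invariance of Q and of admissibility, and the breathing-ball calculus,
inside OneSidedSuffices (the end restriction / wDist bookkeeping is the shared rank-9 item
TameWitnessOfLocalFamily: proved Literature, cited from one Theorems file). Constants (δ, compact
sets K, C) are
existential throughout; no definition items are filed at open (legends are let-bound so every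
signature elaborates today).

CHEAPEST FALSIFIER. (1) Lean, provable-or-refutable now, no physics: SliceIndependence for the
TRIVIAL co-slice pair d = d′ with two different Cauchy
embeddings of flat data into Minkowski space differing on a compact set (N = 0 decomposition by one
inertial frame): if re-anchoring the
flat chart's region O = J⁺(ιX) ∩ I⁻(Ψ₀{x⁰ > τ₀}) from ι′ to ι already breaks `HasExhaustiveCharts`,
the crux is dead as typed and the
Statement is slice-dependent. (2) Literature check for LateKick: is there ANY Einstein-vacuum (or
Einstein–scalar) example of an
exceptional datum whose every late local one-sided perturbation stays exceptional — e.g. one-sided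
accumulation of collapse thresholds
(critical-collapse fine structure) proven at a smooth datum? Run here: `lean check` of all decls +
the crux-only `closes` (Sketch2.lean rc 0, 0 sorries, 2026-08-16, after the T2 re-type; rev-2
logic-only variant also certified by the gate, h21_check_closes ok; rev 5: Sketch.lean with
Statement-only imports and the 6-binder logic-only `closes`, rc 0, 0 sorries, axioms propext /
Classical.choice / Quot.sound, 2026-08-17); `ledger negatives --problem FinalStateConjecture` (1
refuted statement, unrelated: UniformPhotonSphereChannels).

NUMBERS. Items at open: 6 (2 crux, 3 support, 1 assembly); rev 2 (route-repair T2, 2026-08-16): 7;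
revs 3–4 (crux-only `closes`): 6 items; rev 5
(route-repair cone, 2026-08-17): 7 items — 2 ranked cruxes (LateKick r2, SliceIndependence r3), 4
rank-9 known-theorem / provable-now cruxes
(KickTransport, OneSidedSuffices, TameWitnessOfLocalFamily, MGHDExists; the last two shared), 1
Assembly; no support items; route imports: the
Statement only (import cone 84 → 27 modules, Literature modules 78 → 21 = the Statement's own;
unproved named facts riding in: 11 → 0). Known inputs the cruxes are measured against:
Christodoulou1999instability Thm 4.1
(codimension 2 by 2-planes through each exceptional BV datum, spherical scalar field — the only
censorship-genericity theorem); LukOh2017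
Step 4 (open-and-dense genericity in weighted C¹ by a one-parameter compactly supported outgoing
perturbation at r ~ R*); HawkingEllis1973
§7.6 Cauchy stability (W^{5+a} data, compact-closure region 𝒱, diffeomorphism μ with θ⁻¹μθ′ = id on
θ⁻¹(𝒰)); KehleUnger2024 (extremal
threshold crossed by one-parameter families — one-sided by nature); RodnianskiShlapentokhRothman2023
(vacuum naked singularities exist).

DEFINITION REQUESTS. None filed at open: Q, Local, CoSlice are let-bound verbatim in each item (lean
check rc 0). Deferred to the first tenure pass, jointly
with RobustClausewiseGenericity's deferred `InitialDataSet.IsTameFamilyThrough` (our Local = their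
legend Tame at m = 1; not the T2 `IsTameDataFamily`, which TameWitnessOfLocalFamily derives):
`InitialDataSet.IsPinnedCoSliceOf` and `InitialDataSet.IsLocalFamilyThrough` in
Literature/Geometry/Lorentzian (CauchyDevelopment.lean /
Genericity.lean), then 1:1 restatement of the items over them. For the layer-2 split of LateKick:
`InitialDataSet.IsQuietLateSliceOf`
(ε-quiet: future Bondi flux, horizon-area growth, rapidity variation below ε) over BondiMass.lean /
RadiatedEnergy.lean / EventHorizonArea.lean.

Novelty: Searches (2026-08-15; local searchd rc 75, OpenAlex 429 — remote legs used): `lit galaxy search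
"Cauchy stability theorem" --star all` (4 panama books: Hawking–Ellis (read in-book, §7.6 statement
materialised), Dodson, Tipler (ed.), HE Chinese ed.; pdf 0, crabby 0); `lit galaxy search "generic
initial data in the sense of Christodoulou" --star all` (0); `lit galaxy search "weak cosmic
censorship" --star pdf` (15: Kehle–Unger 2211.15742, Mondal 2502.11289 large-data semi-global vacuum
existence, Luk–Moschidis 2204.09855, An–Tan 2402.16250 — none with a transport/localisation
reduction of the genericity quantifier); `lit search --source zbmath "instability naked
singularities Christodoulou"` (9: doi:10.2307/121023, An2025, LiLiu2022, LiuLi2018,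
arXiv:2210.11325, arXiv:2605.16095, arXiv:2402.16250, arXiv:2402.00062, arXiv:2209.06134); `lit
search --source arxiv "localized perturbation late Cauchy hypersurface generic initial data weak
cosmic censorship vacuum"` (0); the card's logged legs (lit read arXiv:1702.05715 pp. 1–12 by the
novelty refuter; Carlotto–Schoen / KIDs legs); in-tree: all 45 Theses headers of this sub (no
WLOG-late/local/one-sided route), Genericity.lean, CauchyDevelopment.lean, MGHDUniqueness.lean
(rigidity proved), NullInfinity.lean (sojourn form is slice-anchored — source of crux
SliceIndependence).
Nearest prior art found: LukOh2017 (arXiv:1702.05715) Step 4(a)–(b) — genericity certified late (on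
the event horizon) and density by a one-parameter compactly s  [refs: 10.2307/121023, 2210.11325, 2605.16095, 2402.16250, 2402.00062, 2209.06134, 1702.05715, doi:10.2307/121023, An2025, LiLiu2022, LiuLi2018, LukOh2017, HawkingEllis1973]

Barriers (technique_class: statement-structure, cauchy-transport, localized-gluing): - technique_class: statement-structure, cauchy-transport, localized-gluing
- Literature.Barriers.FinalStateConjecture.nakedSingularityInstability: on the permitted side — the
line is about HOW positive codimension is certified (late, local, one-sided), never about deleting
'generic'; LateKick's profile species is exactly the barrier's known evasion (Christodoulou / Liu–Li
/ An instability), relocated to a late slice; nakedSingularityInstabilityNarrow likewise.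
- Literature.Barriers.FinalStateConjecture.SlowlyRotatingKerrFrontier: NOT needed for two-from-one
here (gauge shear replaces openness, the card's K3 drops out of the glue); it still binds INSIDE
LateKick through the separation/capture of kicked offenders (full sub-extremal Kerr stability,
multi-Kerr basins) — declared, not evaded; the bet is that one-sided capture of an ε-quiet kicked
configuration is weaker than the rates those theorems prove.
- Literature.Barriers.FinalStateConjecture.AretakisInstability: enters only through the creep
species of LateKick; the kick leaves the closed spin range from one side (KehleUnger2024
one-parameter thresholds), consistent with the barrier's codimension picture;
AretakisInstabilityNarrow likewise.
- Literature.Barriers.FinalStateConjecture.HairyKerrBifurcation: vacuum-specific by content — with a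
massive Klein–Gordon field the Chodosh–Shlapentokh-Rothman hairy holes are quiet bad models that are
NOT kickable into a Kerr basin, so LateKick correctly fails for that matter model; no

Novelty grade: new-combination — route-review grade (refuter rreview-0815T18-6; concurs with the card's two audits): NEW-COMBINATION. Known tools — Cauchy stability transport, compactly supported gauge shear for injectivity, MGHD rigidity for slice change — newly POINTED at the typed Christodoulou quantifier to make 'late, local, o (refuter refuter-rreview-0815T18-6-0, 2026-08-15T19:20:24Z; prior: arXiv:1702.05715 LukOh2017 Step 4 (late certification + one-parameter compactly supported density), doi:10.2307/121023 Christodoulou1999instability Thms 3.1/4.1 (all-data dichotomy then designed perturbation), Chrusciel-Isenberg-Moncrief 1990 / Ringstrom 2006-09 Gowdy SCC (all-data asymptotics -> genericity transported; card audit gen-3), HawkingEllis1973 §7.6 Cauchy stability; BartnikIsenberg2004)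

History (route lifecycle, newest last):
- 2026-08-16T23:47:20Z · rev 2: restated LateKick (stmt-FinalStateConjecture-11694), SliceIndependence (stmt-FinalStateConjecture-11695), OneSidedSuffices (stmt-FinalStateConjecture-11697), Assembly (stmt-FinalStateConjecture-11698) — route-repair (Statement re-typed T2, p126844; glue.unproved): restated LateKick, SliceIndependence (legend Q : (planner-rbadge-FinalStateConjecture-LateLocalK-94de230c-0)
- 2026-08-16T23:53:09Z · rev 4: restated Assembly (stmt-FinalStateConjecture-17993) — route-repair step 3 (glue.non-crux-hypothesis): crux-only `closes : LateKick → SliceIndependence → KickTransport → OneSidedSuffices → MGHDExists → FinalStateCon (planner-rbadge-FinalStateConjecture-LateLocalK-94de230c-0)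
- 2026-08-16T23:53:09Z · rev 4: dropped TameWitnessOfLocalFamily — route-repair step 3 (glue.non-crux-hypothesis): crux-only `closes : LateKick → SliceIndependence → KickTransport → OneSidedSuffices → MGHDExists → FinalStateCon (planner-rbadge-FinalStateConjecture-LateLocalK-94de230c-0)
- 2026-08-17T00:03:30Z · rev 6: restated Assembly (stmt-FinalStateConjecture-18049) — route-repair (cone) rev 6: Assembly restated to the 6-crux chain of the rev-5 logic-only `closes` (TameWitnessOfLocalFamily re-attached at rev 5); the rev-4 5-c (planner-rrepair-FinalStateConjecture-LateLocal-94de230c-0)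
- 2026-08-24T05:55:54Z · DORMANT — reconciler: no traction for 6.6 d (last activity item-evidence-added at 2026-08-17T15:45:33Z); parked, not closed — `ledger route dormant route-FinalStateConjec (operator:999:3505952)
- 2026-08-30T17:07:07Z · REACTIVATED (open) — reconciler: reactivated — activity statement-checked at 2026-08-30T15:54:01Z after parking at 2026-08-24T05:55:54Z (operator:999:440319)
- 2026-09-04T18:00:38Z · DORMANT — reconciler: no traction for 5 d (last activity statement-checked at 2026-08-30T17:29:20Z); parked, not closed — `ledger route dormant route-FinalStateConjecture (operator:999:1791539)

sub-problem: FinalStateConjecture · status: dormant · opened planner-plancard-FinalStateConjecture-FinalSt-19e8901e-0 2026-08-15T18:37:06Z · rev 9 · ledger route-FinalStateConjecture-LateLocalKicks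
GENERATED by the gate from the ledger (D-0016/17). Provers cite these decls: `theorem foo : Summit.FinalStateConjecture.FinalStateConjecture.Theses.LateLocalKicks.<Decl> := …` in Summits/FinalStateConjecture/FinalStateConjecture/Theorems/<Name>.lean.
-/

namespace Summit.FinalStateConjecture.FinalStateConjecture.Theses.LateLocalKicks

open scoped BigOperators Topology Manifold Classical MeasureTheory ProbabilityTheory Matrix InnerProductSpace ComplexConjugate ContinuousMap
open Filter Set Function TopologicalSpace MeasureTheory

attribute [summit_statement] _root_.FinalStateConjecture

-- earlier LateKick (stmt-FinalStateConjecture-11694, replaced 2026-08-16T23:47:20Z -> stmt-FinalStateConjecture-17990): retired by None — ∀ (X : Type) [TopologicalSpace X] [ChartedSpace Literature.Geometry.Lorentzian.E3 X] [IsManifold (𝓡 3) ((⊤ : ℕ∞) : WithTop ℕ∞) X] [T2Space X] [SecondCountableTopology X] [ConnectedSpace X], ∀ d ∈ Literature.Geometry.Lorentzian.admissibleVacuumData X, let Q : Liter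
/-- item stmt-FinalStateConjecture-17990 · crux · rank 2 · open · by planner
why it might fail: It is FSC for the kicked data: needs an all-data late alternative theorem in vacuum AND the re-typed Q (rays, exhaustive, future-oriented capture) of every kicked development; naked-singularity instability known only in symmetry (RSR2023 vacuum ones uncensored); bad c may pile up at 0.
sources: Christodoulou1999instability, Christodoulou1999, RodnianskiShlapentokhRothman2023, An2025, LiuLi2018, KehleUnger2024
[crux] LATE ONE-SIDED LOCAL KICKABILITY (card K1+K2, merged because 'quiet bad models' are not
typable today; re-typed 2026-08-16 to the T2 Statement p126844: the let-bound legend Q is verbatim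
the re-typed settling clause — HasCompleteNullInfinity ∧ ∃ O dd, sub-extremal ∧ O = exteriorOf ∧
RaysStayInClosure ∧ HasExhaustiveCharts ∧ IsFutureOriented — for EVERY MGHD). For every admissible
datum d on X with ¬Q d there are an admissible d′ with CoSlice d d′ (d′ is induced on another Cauchy
hypersurface of a common vacuum Cauchy development of d, the two embeddings equal off a compact set
— by intent a LATE, ε-quiet slice pushed to the future over a compact region) and a local kick G′
through d′ (IsSmoothDataFamily 1, G′ 0 = d′, all members admissible, G′ c = d′ off one compact K)
with ∃ δ > 0, Q(G′ c) for all parameters 0 < c₀ < δ. Physics content: Christodoulou's all-data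
alternative theorem on quiet late slices (hair / creep to extremality / pre-naked-singularity
profile / luminal core / cascade tail) AND a one-sided compactly supported constraint-satisfying
cure of every offender at once. [difficulty: open-problem] -/
@[route_item "route-FinalStateConjecture-LateLocalKicks"]
def LateKick : Prop :=
  ∀ (X : Type) [TopologicalSpace X] [ChartedSpace Literature.Geometry.Lorentzian.E3 X] [IsManifold (𝓡 3) ((⊤ : ℕ∞) : WithTop ℕ∞) X] [T2Space X] [SecondCountableTopology X] [ConnectedSpace X], ∀ d ∈ Literature.Geometry.Lorentzian.admissibleVacuumData X, let Q : Literature.Geometry.Lorentzian.InitialDataSet (𝓡 3) X → Prop := fun D ↦ ∀ 𝒟 : Literature.Geometry.Lorentzian.VacuumCauchyDevelopment D, 𝒟.IsMaximal → Summit.FinalStateConjecture.HasCompleteNullInfinity 𝒟.toCauchyDevelopment ∧ ∃ (O : Set 𝒟.carrier) (dd : Literature.Geometry.Lorentzian.FinalStateDecomposition 𝒟.toSpacetime O 2), (∀ i, Literature.Geometry.Lorentzian.Kerr.IsSubextremal (dd.mass i) (dd.spin i)) ∧ O = Summit.FinalStateConjecture.exteriorOf 𝒟.toCauchyDevelopment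 dd.charted ∧ Summit.FinalStateConjecture.RaysStayInClosure 𝒟.toCauchyDevelopment O ∧ Summit.FinalStateConjecture.HasExhaustiveCharts dd ∧ Summit.FinalStateConjecture.IsFutureOriented dd; let Local : Literature.Geometry.Lorentzian.InitialDataSet (𝓡 3) X → (EuclideanSpace ℝ (Fin 1) → Literature.Geometry.Lorentzian.InitialDataSet (𝓡 3) X) → Prop := fun D G ↦ Literature.Geometry.Lorentzian.InitialDataSet.IsSmoothDataFamily 1 G ∧ G 0 = D ∧ (∀ c, G c ∈ Literature.Geometry.Lorentzian.admissibleVacuumData X) ∧ ∃ K : Set X, IsCompact K ∧ ∀ c, ∀ x ∉ K, (G c).h.inner x = D.h.inner x ∧ (G c).k x = D.k x; let CoSlice : Literature.Geometry.Lorentzian.InitialDataSet (𝓡 3) X → Literature.Geometry.Lorentzian.InitialDataSet (𝓡 3) X → Prop := fun D D' ↦ ∃ (𝒟 : Literature.Geometry.Lorentzian.VacuumCauchyDevelopment D) (𝒟' : Literature.Geometry.Lorentzian.VacuumCauchyDevelopment D') (ψ : 𝒟'.carrier → 𝒟.carrier), ContMDiff (𝓡 4) (𝓡 4) ((⊤ :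 ℕ∞) : WithTop ℕ∞) ψ ∧ Topology.IsOpenEmbedding ψ ∧ 𝒟'.metric.IsIsometricImmersion 𝒟.metric.toPseudoRiemannianMetric ψ ∧ 𝒟'.timeOrientation.PreservesTimeOrientation ψ 𝒟.timeOrientation ∧ 𝒟.metric.IsCauchyHypersurface 𝒟.timeOrientation (Set.range (ψ ∘ 𝒟'.embed)) ∧ ∃ C : Set X, IsCompact C ∧ ∀ x ∉ C, ψ (𝒟'.embed x) = 𝒟.embed x; ¬ Q d → ∃ d' ∈ Literature.Geometry.Lorentzian.admissibleVacuumData X, CoSlice d d' ∧ ∃ G' : EuclideanSpace ℝ (Fin 1) → Literature.Geometry.Lorentzian.InitialDataSet (𝓡 3) X, Local d' G' ∧ ∃ δ : ℝ, 0 < δ ∧ ∀ c : EuclideanSpace ℝ (Fin 1), 0 < c 0 → c 0 < δ → Q (G' c)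

-- earlier SliceIndependence (stmt-FinalStateConjecture-11695, replaced 2026-08-16T23:47:20Z -> stmt-FinalStateConjecture-17991): retired by None — ∀ (X : Type) [TopologicalSpace X] [ChartedSpace Literature.Geometry.Lorentzian.E3 X] [IsManifold (𝓡 3) ((⊤ : ℕ∞) : WithTop ℕ∞) X] [T2Space X] [SecondCountableTopology X] [ConnectedSpace X], ∀ d ∈ Literature.Geometry.Lorentzian.admissibleVacuumData X, ∀ d'
/-- item stmt-FinalStateConjecture-17991 · crux · rank 3 · open · by planner
why it might fail: Q is anchored at ι(X): O = J⁺(ιX)∩I⁻(charted), exhaustiveness ∀τ₁>τ₀, sojourn rays + RaysStayInClosure from ι. CoSlice leaves slices unordered and hole-chart far zones {rᵢ>Rᵢ} free, so chart time is not proper between ιC and ι′C: reused/truncated charts can break image ⊆ J⁺(ιX) or exhaustiveness.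
sources: Christodoulou1999, DafermosLuk2017, arXiv08110354, ONeillSemiRiemannian1983, Geroch1970, BernalSanchez2006
[crux] SLICE INDEPENDENCE OF THE TYPED CONCLUSIONS ALONG PINNED CO-SLICES (re-typed 2026-08-16 to
the T2 legend Q). For admissible d, d′ on X with CoSlice d d′: if d′ has a maximal vacuum Cauchy
development and Q d′ holds, then Q d holds. Proof plan (no PDE): an MGHD 𝒟₁ of d receives the common
development (maximality); its image is causally convex because it contains the Cauchy hypersurface
ι₁(X), so the co-slice is Cauchy in 𝒟₁; with an MGHD of d′, mutual embeddings plus one-jet rigidity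
(`DataEmbedding.eq_id_of_comp_embed_eq'`, `mghd_unique_cauchy`, proved) make 𝒟₁ re-anchored at the
co-slice an MGHD of d′, to which Q d′ applies; then transfer the conclusions across anchors
differing on a compact C: sojourn completeness (rays and the normalisation g(γ′,ν) = −1 agree off C;
B₀ ↦ ι⁻¹((J⁻ ∪ J⁺)(ι′B₀′) ∩ ιX), B₁ ↦ B₁′ ∪ C); the decomposition (same charts truncated to a later
τ₀, region O = J⁺(ιX) ∩ I⁻(charted), exhaustiveness across the compact slab J⁺(ιC) ∩ J⁻(ι′X) from
HasExhaustiveCharts at every τ₁); IsFutureOriented is chart-intrinsic and transfers verbatim;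
RaysStayInClosure: a normalised future-complete null ray from ι p crosses the Cauchy co-slice once
and continues, up to p -/
@[route_item "route-FinalStateConjecture-LateLocalKicks"]
def SliceIndependence : Prop :=
  ∀ (X : Type) [TopologicalSpace X] [ChartedSpace Literature.Geometry.Lorentzian.E3 X] [IsManifold (𝓡 3) ((⊤ : ℕ∞) : WithTop ℕ∞) X] [T2Space X] [SecondCountableTopology X] [ConnectedSpace X], ∀ d ∈ Literature.Geometry.Lorentzian.admissibleVacuumData X, ∀ d' ∈ Literature.Geometry.Lorentzian.admissibleVacuumData X, let Q : Literature.Geometry.Lorentzian.InitialDataSet (𝓡 3) X → Prop := fun D ↦ ∀ 𝒟 : Literature.Geometry.Lorentzian.VacuumCauchyDevelopment D, 𝒟.IsMaximal → Summit.FinalStateConjecture.HasCompleteNullInfinity 𝒟.toCauchyDevelopment ∧ ∃ (O : Set 𝒟.carrier) (dd : Literature.Geometry.Lorentzian.FinalStateDecomposition 𝒟.toSpacetime O 2), (∀ i, Literature.Geometry.Lorentzian.Kerr.IsSubextremal (dd.mass i) (dd.spin i)) ∧ O = Summit.FinalStateConjecture.exteriorOf 𝒟.toCauchyDevelopment dd.charted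 ∧ Summit.FinalStateConjecture.RaysStayInClosure 𝒟.toCauchyDevelopment O ∧ Summit.FinalStateConjecture.HasExhaustiveCharts dd ∧ Summit.FinalStateConjecture.IsFutureOriented dd; let CoSlice : Literature.Geometry.Lorentzian.InitialDataSet (𝓡 3) X → Literature.Geometry.Lorentzian.InitialDataSet (𝓡 3) X → Prop := fun D D' ↦ ∃ (𝒟 : Literature.Geometry.Lorentzian.VacuumCauchyDevelopment D) (𝒟' : Literature.Geometry.Lorentzian.VacuumCauchyDevelopment D') (ψ : 𝒟'.carrier → 𝒟.carrier), ContMDiff (𝓡 4) (𝓡 4) ((⊤ : ℕ∞) : WithTop ℕ∞) ψ ∧ Topology.IsOpenEmbedding ψ ∧ 𝒟'.metric.IsIsometricImmersion 𝒟.metric.toPseudoRiemannianMetric ψ ∧ 𝒟'.timeOrientation.PreservesTimeOrientation ψ 𝒟.timeOrientation ∧ 𝒟.metric.IsCauchyHypersurface 𝒟.timeOrientation (Set.range (ψ ∘ 𝒟'.embed)) ∧ ∃ C : Set X, IsCompact C ∧ ∀ x ∉ C, ψ (𝒟'.embed x) = 𝒟.embed x; CoSlice d d' → (∃ 𝒟'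 : Literature.Geometry.Lorentzian.VacuumCauchyDevelopment d', 𝒟'.IsMaximal) → Q d' → Q d

/-- item stmt-FinalStateConjecture-11696 · crux · rank 9 · open · by planner
why it might fail: Only as typed: ONE compact K for all c and joint C^∞ in (c,x) of Cauchy-stability-transported data, admissibility of every member, CoSlice unoriented (d′ may dip below ιX); smooth c-dependence of MGHD slabs for this class is folklore (Kato), not in print.
sources: HawkingEllis1973, ChoquetBruhatGeroch1969CMP, Kato1975, Ringstrom2009, FouresBruhat1952
[support] CAUCHY-STABILITY TRANSPORT OF LOCAL KICKS ALONG PINNED CO-SLICES (card L1, known theorem,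
XL formalisation). For admissible d, d′ with CoSlice d d′ and every local kick G′ through d′ there
are a local kick G through d and δ > 0 such that CoSlice (G c) (G′ c) for all |c| < δ. Proof plan:
time-reversed Cauchy stability theorem (HawkingEllis1973 §7.6, property (1) = pinning) on a region 𝒱
with compact closure containing the slab between the two slices over C and the domain of influence
of the kick support; smooth joint dependence on c (Kato1975, differentiate the reduced equations in
c) gives IsSmoothDataFamily 1; constraints for induced data, completeness and the DR end are
inherited because G c = d off ONE compact set (finite speed of propagation); beyond δ reparametrise
c smoothly into (−δ, δ). No weighted norms: locality first, then transport. [difficulty: XL] -/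
@[route_item "route-FinalStateConjecture-LateLocalKicks"]
def KickTransport : Prop :=
  ∀ (X : Type) [TopologicalSpace X] [ChartedSpace Literature.Geometry.Lorentzian.E3 X] [IsManifold (𝓡 3) ((⊤ : ℕ∞) : WithTop ℕ∞) X] [T2Space X] [SecondCountableTopology X] [ConnectedSpace X], ∀ d ∈ Literature.Geometry.Lorentzian.admissibleVacuumData X, ∀ d' ∈ Literature.Geometry.Lorentzian.admissibleVacuumData X, let Local : Literature.Geometry.Lorentzian.InitialDataSet (𝓡 3) X → (EuclideanSpace ℝ (Fin 1) → Literature.Geometry.Lorentzian.InitialDataSet (𝓡 3) X) → Prop := fun D G ↦ Literature.Geometry.Lorentzian.InitialDataSet.IsSmoothDataFamily 1 G ∧ G 0 = D ∧ (∀ c, G c ∈ Literature.Geometry.Lorentzian.admissibleVacuumData X) ∧ ∃ K : Set X, IsCompact K ∧ ∀ c, ∀ x ∉ K, (G c).h.inner x = D.h.inner x ∧ (G c).k x = D.k x; let CoSlice : Literature.Geometry.Lorentzian.InitialDataSet (𝓡 3) X → Literature.Geometry.Lorentzian.InitialDataSet (𝓡 3) X → Prop := fun D D' ↦ ∃ (𝒟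 : Literature.Geometry.Lorentzian.VacuumCauchyDevelopment D) (𝒟' : Literature.Geometry.Lorentzian.VacuumCauchyDevelopment D') (ψ : 𝒟'.carrier → 𝒟.carrier), ContMDiff (𝓡 4) (𝓡 4) ((⊤ : ℕ∞) : WithTop ℕ∞) ψ ∧ Topology.IsOpenEmbedding ψ ∧ 𝒟'.metric.IsIsometricImmersion 𝒟.metric.toPseudoRiemannianMetric ψ ∧ 𝒟'.timeOrientation.PreservesTimeOrientation ψ 𝒟.timeOrientation ∧ 𝒟.metric.IsCauchyHypersurface 𝒟.timeOrientation (Set.range (ψ ∘ 𝒟'.embed)) ∧ ∃ C : Set X, IsCompact C ∧ ∀ x ∉ C, ψ (𝒟'.embed x) = 𝒟.embed x; CoSlice d d' → ∀ G' : EuclideanSpace ℝ (Fin 1) → Literature.Geometry.Lorentzian.InitialDataSet (𝓡 3) X, Local d' G' → ∃ G : EuclideanSpace ℝ (Fin 1) → Literature.Geometry.Lorentzian.InitialDataSet (𝓡 3) X, Local d G ∧ ∃ δ : ℝ, 0 < δ ∧ ∀ c : EuclideanSpace ℝ (Fin 1), |c 0| < δ → CoSlice (G c) (G' c)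

/-- item stmt-FinalStateConjecture-17502 · crux · rank 9 · open · by planner
why it might fail: Only as typed: IsTameDataFamily on the collared end e.restrict (e.R+1) needs every member's chart components to equal d's beyond R₁ incl. junk values inside the collar, and constant mass via IsStronglyAsymptoticallyFlatDR.congr_of_eqOn_far; candidate proof (rc 0) says both hold.
sources: Christodoulou1999, arXiv:0811.0354, Bartnik1986
[support] LOCAL COMPACTLY SUPPORTED IMMERSED FAMILIES ARE TAME WITNESSES (provable now; the T2
packaging lemma, tame analogue of PhotonSphereChannels.isChristodoulouGeneric_one_of_local /
hasCodimAtLeastIn_one_of_local). For a property P of data on X: if through every admissible d with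
¬P d there is a jointly smooth F : ℝ¹ → data with F 0 = d, IsImmersedAtZero 1 F, all of whose
members agree with d (h and k pointwise) off ONE compact K ⊆ X, which is injective and admissible
for |c₀| < ε and has P (F c) for 0 < |c₀| < ε, then P is TAME-Christodoulou-generic in
admissibleVacuumData X with codimension 1 (IsTameChristodoulouGeneric … P 1: one fixed AFEnd,
IsTameDataFamily, IsImmersedAtZero, injective, admissible, escaping). Proof sketch: (i) squash ℝ¹
onto the good interval by σ(c) = (ε·arctan c₀/2)·e₀ (squash_spec: injective, σ 0 = 0, |σ c| < ε);
IsSmoothDataFamily 1 (F ∘ σ) by isSmoothDataFamily_comp; injectivity / admissibility / escape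
exactly as in hasCodimAtLeastIn_one_of_local; immersion survives since dσ(0) = (ε/2)·id and a
non-zero fderiv forces differentiability (chain rule). (ii) THE END: d ∈ admissibleVacuumData X
gives a sole end e and a mass M with IsStronglyAsymptoticall -/
@[route_item "route-FinalStateConjecture-LateLocalKicks"]
def TameWitnessOfLocalFamily : Prop :=
  ∀ (X : Type) [TopologicalSpace X] [ChartedSpace Literature.Geometry.Lorentzian.E3 X] [IsManifold (𝓡 3) ((⊤ : ℕ∞) : WithTop ℕ∞) X] [T2Space X] [SecondCountableTopology X] [ConnectedSpace X] (P : Literature.Geometry.Lorentzian.InitialDataSet (𝓡 3) X → Prop), (∀ d ∈ Literature.Geometry.Lorentzian.admissibleVacuumData X, ¬ P d → ∃ (ε : ℝ) (F : EuclideanSpace ℝ (Fin 1) → Literature.Geometry.Lorentzian.InitialDataSet (𝓡 3) X), 0 < ε ∧ Literature.Geometry.Lorentzian.InitialDataSet.IsSmoothDataFamily 1 F ∧ F 0 = d ∧ Literature.Geometry.Lorentzian.InitialDataSet.IsImmersedAtZero 1 F ∧ (∃ K : Set X, IsCompact K ∧ ∀ c, ∀ x ∉ K, (F c).h.inner x =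 d.h.inner x ∧ (F c).k x = d.k x) ∧ (∀ c c' : EuclideanSpace ℝ (Fin 1), |c 0| < ε → |c' 0| < ε → F c = F c' → c = c') ∧ (∀ c : EuclideanSpace ℝ (Fin 1), |c 0| < ε → F c ∈ Literature.Geometry.Lorentzian.admissibleVacuumData X) ∧ ∀ c : EuclideanSpace ℝ (Fin 1), c ≠ 0 → |c 0| < ε → P (F c)) → Literature.Geometry.Lorentzian.InitialDataSet.IsTameChristodoulouGeneric (Literature.Geometry.Lorentzian.admissibleVacuumData X) P 1

-- earlier OneSidedSuffices (stmt-FinalStateConjecture-11697, replaced 2026-08-16T23:47:20Z -> stmt-FinalStateConjecture-17992): retired by None — ∀ (X : Type) [TopologicalSpace X] [ChartedSpace Literature.Geometry.Lorentzian.E3 X] [IsManifold (𝓡 3) ((⊤ : ℕ∞) : WithTop ℕ∞) X] [T2Space X] [SecondCountableTopology X] [ConnectedSpace X], ∀ d ∈ Literature.Geometry.Lorentzian.admissibleVacuumData X, let Q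
/-- item stmt-FinalStateConjecture-17992 · crux · rank 9 · open · by planner
why it might fail: Hinges on Q(ψ^*D) ↔ Q(D) for a compactly supported diffeomorphism ψ: every typed MGHD of ψ^*D must re-anchor to one of D (IsMaximal over ALL typed developments) and the sojourn/ray clauses must be ψ-equivariant as typed; immersion needs h_d(x₀)(v,v) ≠ 0 via breatheFamily.
sources: BartnikIsenberg2004, Christodoulou1999, Christodoulou2008, Literature.Geometry.Lorentzian.AFEnd.breatheFamily_h_inner_center, Literature.Geometry.Lorentzian.InitialDataSet.isImmersedAtZero_breatheCurve
[support] ONE-SIDED LOCAL KICKS SUFFICE, T2 form (card L4 without openness: two-from-one by a GAUGE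
SHEAR, output local and immersed; provable now; re-typed 2026-08-16). If an admissible d carries a
local kick G (legend Local) with Q(G c) for 0 < c₀ < δ, then there are ε > 0 and a jointly smooth F
: ℝ¹ → data with F 0 = d, IMMERSED at 0 (IsImmersedAtZero 1 F), equal to d (h and k pointwise) off
ONE compact set, injective and admissible for |c₀| < ε, with Q(F c) for 0 < |c₀| < ε — verbatim the
hypothesis shape of the shared T2 packaging item TameWitnessOfLocalFamily with P ↦ Q (the glue adds
∃ MGHD from MGHDExists). Construction: F(c) := ψ_{c₀}^*(G(β(c))) with β(c) = (δ/2)·c₀²/(1+c₀²)·e₀ ∈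
[0, δ/2) (β > 0 off 0, β′(0) = 0) and ψ_s the breathing-ball diffeomorphisms of
Theorems/RobustClausewiseGenericityGaugeEnrichment.lean (AFEnd.breatheFamily: supported in a chart
ball B̄, ψ₀ = id, ψ_s(x₀) = x₀, Dψ_s(x₀) = (1+σ(s))·id; BartnikIsenberg2004 §2): (i) Q and
admissibility are invariant under pull-back by a diffeomorphism ψ of X — every MGHD of ψ^*D is an
MGHD of D re-anchored along ψ; range ι, the family of rays from ι(X), O, the charts,
HasExhaustiveCharts, IsFutureOriented are unchang -/
@[route_item "route-FinalStateConjecture-LateLocalKicks"]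
def OneSidedSuffices : Prop :=
  ∀ (X : Type) [TopologicalSpace X] [ChartedSpace Literature.Geometry.Lorentzian.E3 X] [IsManifold (𝓡 3) ((⊤ : ℕ∞) : WithTop ℕ∞) X] [T2Space X] [SecondCountableTopology X] [ConnectedSpace X], ∀ d ∈ Literature.Geometry.Lorentzian.admissibleVacuumData X, let Q : Literature.Geometry.Lorentzian.InitialDataSet (𝓡 3) X → Prop := fun D ↦ ∀ 𝒟 : Literature.Geometry.Lorentzian.VacuumCauchyDevelopment D, 𝒟.IsMaximal → Summit.FinalStateConjecture.HasCompleteNullInfinity 𝒟.toCauchyDevelopment ∧ ∃ (O : Set 𝒟.carrier) (dd : Literature.Geometry.Lorentzian.FinalStateDecomposition 𝒟.toSpacetime O 2), (∀ i, Literature.Geometry.Lorentzian.Kerr.IsSubextremal (dd.mass i) (dd.spin i)) ∧ O = Summit.FinalStateConjecture.exteriorOf 𝒟.toCauchyDevelopment dd.charted ∧ Summit.FinalStateConjecture.RaysStayInClosure 𝒟.toCauchyDevelopment O ∧ Summit.FinalStateConjecture.HasExhaustiveCharts dd ∧ Summit.FinalStateConjecture.IsFutureOriented dd; let Local : Literature.Geometry.Lorentzian.InitialDataSet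 (𝓡 3) X → (EuclideanSpace ℝ (Fin 1) → Literature.Geometry.Lorentzian.InitialDataSet (𝓡 3) X) → Prop := fun D G ↦ Literature.Geometry.Lorentzian.InitialDataSet.IsSmoothDataFamily 1 G ∧ G 0 = D ∧ (∀ c, G c ∈ Literature.Geometry.Lorentzian.admissibleVacuumData X) ∧ ∃ K : Set X, IsCompact K ∧ ∀ c, ∀ x ∉ K, (G c).h.inner x = D.h.inner x ∧ (G c).k x = D.k x; (∃ G : EuclideanSpace ℝ (Fin 1) → Literature.Geometry.Lorentzian.InitialDataSet (𝓡 3) X, Local d G ∧ ∃ δ : ℝ, 0 < δ ∧ ∀ c : EuclideanSpace ℝ (Fin 1), 0 < c 0 → c 0 < δ → Q (G c)) → ∃ (ε : ℝ) (F : EuclideanSpace ℝ (Fin 1) → Literature.Geometry.Lorentzian.InitialDataSet (𝓡 3) X), 0 < ε ∧ Literature.Geometry.Lorentzian.InitialDataSet.IsSmoothDataFamily 1 F ∧ F 0 = d ∧ Literature.Geometry.Lorentzian.InitialDataSet.IsImmersedAtZero 1 F ∧ (∃ K : Set X, IsCompact K ∧ ∀ c, ∀ x ∉ K, (F c).h.inner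 x = d.h.inner x ∧ (F c).k x = d.k x) ∧ (∀ c c' : EuclideanSpace ℝ (Fin 1), |c 0| < ε → |c' 0| < ε → F c = F c' → c = c') ∧ (∀ c : EuclideanSpace ℝ (Fin 1), |c 0| < ε → F c ∈ Literature.Geometry.Lorentzian.admissibleVacuumData X) ∧ ∀ c : EuclideanSpace ℝ (Fin 1), c ≠ 0 → |c 0| < ε → Q (F c)

/-- item stmt-FinalStateConjecture-9937 · crux · rank 9 · open · by planner
why it might fail: Only as typed: in print (CBG 1969 Thm 3) but here the undischarged XL fact choquetBruhat_geroch_exists_mghd_cauchy; IsMaximal asks EVERY typed VacuumCauchyDevelopment.{0} of D to embed into one 𝒟 — a rogue typed development falsifies it (first render over VacuumDevelopment: isEmpty).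
sources: ChoquetBruhatGeroch1969CMP, Sbierski2016AHP, Ringstrom2009, Literature.Geometry.Lorentzian.choquetBruhat_geroch_exists_mghd_cauchy
[support] every admissible datum has a maximal globally hyperbolic vacuum development, stated over
the repaired structure `VacuumCauchyDevelopment` (the corrected form of the deprecated
`choquetBruhat_geroch_exists_mghd`, recorded in `CauchyProblemExistenceDefect`);
Choquet-Bruhat–Geroch 1969 Thm. 3, Sbierski 2016 Thm. 2.6. Known theorem; large formalisation;
shared by every route of this summit. [difficulty: XL] -/
@[route_item "route-FinalStateConjecture-LateLocalKicks"]
def MGHDExists : Prop :=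
  ∀ (X : Type) [TopologicalSpace X] [ChartedSpace Literature.Geometry.Lorentzian.E3 X] [IsManifold (𝓡 3) ((⊤ : ℕ∞) : WithTop ℕ∞) X] [T2Space X] [SecondCountableTopology X] [ConnectedSpace X], ∀ D ∈ Literature.Geometry.Lorentzian.admissibleVacuumData X, ∃ 𝒟 : Literature.Geometry.Lorentzian.VacuumCauchyDevelopment D, 𝒟.IsMaximal

-- earlier Assembly (stmt-FinalStateConjecture-11698, replaced 2026-08-16T23:47:20Z -> stmt-FinalStateConjecture-17993): retired by None — LateKick → SliceIndependence → KickTransport → OneSidedSuffices → MGHDExists → _root_.FinalStateConjecture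
-- earlier Assembly (stmt-FinalStateConjecture-17993, replaced 2026-08-16T23:53:09Z -> stmt-FinalStateConjecture-18049): retired by None — LateKick → SliceIndependence → KickTransport → OneSidedSuffices → TameWitnessOfLocalFamily → MGHDExists → _root_.FinalStateConjecture
-- earlier Assembly (stmt-FinalStateConjecture-18049, replaced 2026-08-17T00:03:30Z -> stmt-FinalStateConjecture-18062): retired by None — LateKick → SliceIndependence → KickTransport → OneSidedSuffices → MGHDExists → _root_.FinalStateConjecture
/-- item stmt-FinalStateConjecture-18062 · assembly · rank 1 · open · by planner
sources: Christodoulou1999, Christodoulou1999instability, HawkingEllis1973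
[assembly] LateKick → SliceIndependence → KickTransport → OneSidedSuffices →
TameWitnessOfLocalFamily → MGHDExists → FinalStateConjecture — the crux-only chain the deciding
theorem `closes` proves (rev 5, 2026-08-17: pure logic over the six rank-ed items; the tame
packaging is the shared hypothesis TameWitnessOfLocalFamily, stmt-FinalStateConjecture-17502, no
Literature import beyond the Statement). Restated from the rev-4 5-chain (which discharged the
packaging in Lean via TameFamilyOffCompact and is still true, but whose imports carried 11 unproved
positive-mass-family facts into the route cone); same signature as the rev-3 Assembly
(stmt-FinalStateConjecture-17993, retired at rev 4). Proof = `closes` itself. [deps: LateKick,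
SliceIndependence, KickTransport, OneSidedSuffices, TameWitnessOfLocalFamily, MGHDExists]
[difficulty: S] -/
@[route_item "route-FinalStateConjecture-LateLocalKicks"]
def Assembly : Prop :=
  LateKick → SliceIndependence → KickTransport → OneSidedSuffices → TameWitnessOfLocalFamily → MGHDExists → _root_.FinalStateConjecture

/-! D-0027 §2.1 — DECIDING THEOREM (planner-authored via `route open/edit --closes-file`; by planner-rbadge-FinalStateConjecture-LateLocalK-94de230c-g2-0 2026-08-17T00:27:30Z):
its hypotheses are this route's items and its conclusion the sub-problem Statement (glue_lint), and it elaborates with this file. -/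

@[closes "route-FinalStateConjecture-LateLocalKicks"] theorem closes (hLate : LateKick) (hSlice : SliceIndependence) (hTrans : KickTransport)
    (hOne : OneSidedSuffices) (hTame : TameWitnessOfLocalFamily) (hMGHD : MGHDExists) :
    _root_.FinalStateConjecture := by
  -- logic only over the six items (no `unfold`; the Statement is used by name): re-certified
  -- 2026-08-17 by route-repair g2 after a stale fullbuild stamp that quoted the rev-1 proof
  intro X _ _ _ _ _ _
  refine hTame X _ ?_
  intro d hdA hnP
  have hE : ∀ D ∈ Literature.Geometry.Lorentzian.admissibleVacuumData X,
      ∃ 𝒟 : Literature.Geometry.Lorentzian.VacuumCauchyDevelopment D, 𝒟.IsMaximal := hMGHD X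
  -- the late one-sided local kick, transported to `d` and certified by slice independence
  obtain ⟨d', hd'A, hco, G', hloc', δ', hδ', hgood'⟩ :=
    hLate X d hdA (fun hQ ↦ hnP ⟨hE d hdA, hQ⟩)
  obtain ⟨G, hloc, δ, hδ, hfam⟩ := hTrans X d hdA d' hd'A hco G' hloc'
  -- two-from-one by the gauge shear: a local immersed window family through `d`
  obtain ⟨ε, F, hε, hF, hF0, hFimm, hFK, hFinj, hFA, hFQ⟩ := hOne X d hdA ⟨G, hloc,
    min δ δ', lt_min hδ hδ', fun c hc0 hcδ ↦ hSlice X (G c) (hloc.2.2.1 c) (G' c) (hloc'.2.2.1 c)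
      (hfam c (by rw [abs_of_pos hc0]; exact lt_of_lt_of_le hcδ (min_le_left _ _)))
      (hE (G' c) (hloc'.2.2.1 c)) (hgood' c hc0 (lt_of_lt_of_le hcδ (min_le_right _ _)))⟩
  -- the tame packaging is the shared item `TameWitnessOfLocalFamily` (applied above with
  -- P := the summit property); it remains to hand it the window family, upgrading Q to P by MGHD
  -- existence at every admissible member
  exact ⟨ε, F, hε, hF, hF0, hFimm, hFK, hFinj, hFA, fun c hc hcε ↦
    ⟨hE (F c) (hFA c hcε), hFQ c hc hcε⟩⟩

end Summit.FinalStateConjecture.FinalStateConjecture.Theses.LateLocalKicks
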